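import Literature.IUT.HodgeTheaters.InitialThetaDataBadLocalFrobenioidOfDoubleUnderline
import Literature.IUT.HodgeTheaters.ReconstructibleAlongCriterion
import Literature.AlgebraicGeometry.Frobenioids.CosetBaseEquivalenceObjects
import Literature.AnabelianGeometry.SemiGraphs.TemperedDecompositionCompact
import HarnessLib

/-!
# [IUTchI] Example 3.2 (vi) (a) AT THE GENUINE BAD DATUM: `D⊢_v̲ ⊆ D_v̲` from `D_v̲ = 𝓑^temp(X̲̲_v̲)⁰`, conditional on
# the tempered form of [AbsAnab] Lemma 1.3.8 («`Δ^tp_{X̲̲_v̲} ⊆ Π^tp_{X̲̲_v̲}` is characteristic») displayed by name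

S. Mochizuki, *Inter-universal Teichmüller theory I*, kurims manuscript (May 2020), Example 3.2 (vi) p. 73:
"(a) the subcategory `D⊢_v ⊆ D_v` may be reconstructed category-theoretically from `D_v` [cf. [AbsAnab], Lemma
1.3.8]" [claim: Mochizuki2012, status: disputed] (D-0012 claim key, series status DISPUTED — this file is a PROOF-ONLY
composition of landed theorems; nothing of the series is asserted and no side is taken on [IUTchIII] Cor. 3.12).
DAG node `IUTchI:Ex3.2(vi)` (kernel decl `BadLocalFrobenioid.DdashFromD` = `N_IUTchI_Ex3_2_vi` of
`Summits/ABC/IUTFork/DAGL5p.lean`), row E32vi/a of `plan/L5/SUBDAG-IUTchI-Ex32.md` (status before this file: "(γ)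
schema … at ofKits: needs «every self-equivalence of CosetCat Π_v preserves the essential image of pull aug» =
anabelian input on Π_v … OPEN").
S. Mochizuki, *The absolute anabelian geometry of hyperbolic curves* (2004), Lemma 1.3.8 p. 18: an isomorphism of
arithmetic fundamental groups of hyperbolic curves over finite extensions of `ℚ_p` "is compatible with the quotients
`Π ↠ G_{Kᵢ}`" [cite: MochizukiAbsAnab2004, Lemma 1.3.8 p.18] — here, for the TEMPERED fundamental group
`Π^tp_{X̲̲_v}` of Ex. 3.2 (i) (`D_v := 𝓑^temp(X̲̲_v)⁰`, p. 70), in the unfolded shape `hΔ` ("every bicontinuous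
automorphism of `Π_v` carries `Δ_v := Ker(Π_v ↠ G_v)` onto itself"), a DISPLAYED hypothesis of every closer below
(never asserted).
S. Mochizuki, *The geometry of Frobenioids II* (2008), proof of Thm. 2.4 (ii), kurims ms p. 21 l. 4–17 (the statement of
Thm. 2.4 opens p. 19 l. 7; clause (ii) itself, p. 20 l. 4–11, is the `F_N(A_i) ⥲ ℤ/Nℤ` compatibility): an equivalence of
(tempered) coset base categories is induced by a bicontinuous isomorphism of groups, print's pair being "well-defined up to
composition with automorphisms of the pair `(G₂, K̄₂^×)` induced by elements of `G₂`" [i.e., our gloss: up to an inner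
automorphism] — abc-iut-L1's `BaseGaloisSystem.exists_continuousMulEquiv_forall_obj_conj_of_cosetCat_equivalence`, stated for
TEMPERED Galois-countable groups, so the bad place needs no profinite detour [cite: MochizukiFrdII2008, proof of Thm 2.4 (ii) ms p.21].

WHAT IS PROVED (the exact bad-place twin of `GoodLocalFrobenioidOfGaloisDdash.lean`, [IUTchI] Ex. 3.3 (iii) (a)).
* `BadLocalGroupDatum.incl_essImage_invariant_of_forall_map_ker` — for a bad-place group datum `T` of Ex. 3.2
  (`aug : Π_v → G_v` continuous open, `Π_Ÿ ⊆ Π_v`; abc-iut-L5-t2's `BadLocalFrobenioidBases.lean`) on a TEMPERED,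
  Galois-countable `Π_v`: IF `hΔ` THEN every self-equivalence of `D_v = CosetCat Π_v` preserves the essential image
  of `D⊢_v = CosetCat G_v ↪ D_v` (pull-back along `aug`).  Mechanism as in the good case: the self-equivalence acts
  on objects through a bicontinuous `φ : Π_v ≃ₜ* Π_v` up to conjugacy; `φ(Δ_v) = Δ_v ⊴ Π_v` ⇒ the objects `Π_v/H`,
  `H ⊇ Δ_v` (= the essential image of `D⊢_v`) are preserved.
* `BadLocalFrobenioid.ddashFromD_ofKits_of_forall_map_ker` — `DdashFromD` for the assembly `ofKits` (REAL bases,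
  REAL `C⊢_v ⥲ C^Θ_v`, tempered side INPUT; `BadLocalFrobenioidOfKits.lean`) modulo {`hP` tempered,
  Galois-countable, `hΔ`}, through abc-iut-w4-d047's socket `BadLocalFrobenioid.ddashFromD_of_essImage_invariant`;
  `…_of_injective` — the binder `hΔ` is EMPTY when `aug` is injective (no covering: `Π_v = G_v`), non-vacuity of the
  conditional.
* `InitialThetaData.ddashFromD_badLocalFrobenioidAt_of_forall_map_ker` — **(vi)(a) for the initial Θ-datum `D`
  ([IUTchI] Def. 3.1) at `v̲ = w ∣ v ∈ V(F)^bad`, `K_v̲ = K_w`** (`InitialThetaData.badLocalFrobenioidAt`, p442528),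
  for EVERY input group datum `T` on a tempered Galois-countable `Π_v̲` and EVERY tempered-side input `Kt`, modulo
  `hΔ` for `T.aug`.
* `InitialThetaData.ddashFromD_badLocalFrobenioidAtDoubleUnderline_of_forall_map_ker` — **(vi)(a) AT THE [EtTh] §1
  OBJECTS** (`badLocalFrobenioidAtDoubleUnderline`, p454048: `Π_v̲ := Π^tp_{X̲̲}` = the open subgroup `C.Huu ≤ Π^tp_X`
  of abc-iut-L2's double-underline curve, `aug := ι ∘ aug_{G_K}|`): temperedness and Galois-countability of
  `Π^tp_{X̲̲}` are THEOREMS (abc-iut-L3's `GroupLevelData.isTempered/secondCountableTopology` for `Π^tp_X` +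
  `IsTempered.subgroup_of_isClosed`), so the ONLY displayed hypothesis is `hΔ` in the `ι`-FREE form
  "`Δ^tp_{X̲̲} := Δ^tp_X ∩ Π^tp_{X̲̲}` is carried onto itself by every bicontinuous automorphism of `Π^tp_{X̲̲}`"
  (`BadLocalGroupDatum.ker_aug_ofDoubleUnderline` identifies `Ker(aug)` with it).
No new definition, instance or notation.  typed ≠ proved elsewhere; DISCHARGED here = proved as typed under OUR
kernel, modulo the named hypotheses displayed in each signature; nothing asserts that a `ThetaSetting` arises from an
actual Tate curve.
-/

noncomputable section

namespace Literature.IUT.HodgeTheaters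

open CategoryTheory Literature.AnabelianGeometry.SemiGraphs Literature.AlgebraicGeometry.Frobenioids
open Literature.AlgebraicGeometry.Frobenioids.PadicFrd Literature.AnabelianGeometry.EtaleTheta Topology

universe u

/-! ### §1 The essential image of `D⊢_v ⊆ D_v` is invariant when `Δ_v = Ker(aug)` is characteristic -/

namespace BadLocalGroupDatum

variable {G : Type u} [Group G] [TopologicalSpace G] {P : Type u} [Group P] [TopologicalSpace P]
  (T : BadLocalGroupDatum G P)

/-- **Essential-image invariance of `D⊢_v ⊆ D_v` for a bad-place group datum** ([IUTchI] Ex. 3.2 (i): `D_v =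
𝓑^temp(X̲̲_v)⁰ = CosetCat Π_v ⊇ D⊢_v = 𝓑(K_v)⁰ = CosetCat G_v`, pulled back along `aug : Π_v ↠ G_v`), for `Π_v`
TEMPERED and Galois-countable, CONDITIONAL on [AbsAnab] Lem. 1.3.8 in the tempered unfolded form `hΔ`: "`Δ_v :=
Ker(Π_v ↠ G_v)` is carried onto itself by every bicontinuous automorphism of `Π_v`".  Proof: a self-equivalence `e`
of `CosetCat Π_v` acts on objects through a bicontinuous `φ : Π_v ≃ₜ* Π_v` up to conjugacy ([FrdII] Thm. 2.4 (ii),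
`BaseGaloisSystem.exists_continuousMulEquiv_forall_obj_conj_of_cosetCat_equivalence`); `φ(Δ_v) = Δ_v` and
`Δ_v ⊴ Π_v` give that `e` preserves the objects `Π_v/H`, `H ⊇ Δ_v` = the essential image of `D⊢_v`.
([IUTchI] Ex 3.2 (vi) (a) p.73) [claim: Mochizuki2012, status: disputed] -/
theorem incl_essImage_invariant_of_forall_map_ker [IsTopologicalGroup P] [SecondCountableTopology P]
    (hP : IsTempered P) (hΔ : ∀ φ : P ≃ₜ* P, T.aug.ker.map φ.toMulEquiv.toMonoidHom = T.aug.ker)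
    (e : T.Dv ≌ T.Dv) (A : T.Ddash) : T.incl.essImage (e.functor.obj (T.incl.obj A)) := by
  change (CosetCat.pull T.aug T.continuous_aug T.surjective_aug).essImage
    (e.functor.obj ((CosetCat.pull T.aug T.continuous_aug T.surjective_aug).obj A))
  obtain ⟨φ, hφ⟩ :=
    BaseGaloisSystem.exists_continuousMulEquiv_forall_obj_conj_of_cosetCat_equivalence hP hP
      (E := (e : CosetCat P ≌ CosetCat P))
  obtain ⟨c, hc'⟩ := hφ ((CosetCat.pull T.aug T.continuous_aug T.surjective_aug).obj A)
  -- `Δ_v ⊆ H'` for `e(Π_v/aug⁻¹V) = Π_v/H'`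
  have hker : T.aug.ker ≤
      ((e.functor.obj ((CosetCat.pull T.aug T.continuous_aug T.surjective_aug).obj A)).sg : Subgroup P) := by
    intro x hx
    have hy : c * x * c⁻¹ ∈ T.aug.ker := T.aug.normal_ker.conj_mem x hx c
    rw [← hΔ φ, Subgroup.mem_map] at hy
    obtain ⟨g, hg, hgx⟩ := hy
    have hgA : g ∈ ((CosetCat.pull T.aug T.continuous_aug T.surjective_aug).obj A).sg := by
      change g ∈ A.sg.comap T.aug T.continuous_aug
      rw [OpenSubgroup.mem_comap, MonoidHom.mem_ker.mp hg]
      exact A.sg.one_mem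
    have h := (hc' g).1 hgA
    have hgx' : φ g = c * x * c⁻¹ := hgx
    rwa [hgx', show c⁻¹ * (c * x * c⁻¹) * c = x by group] at h
  refine ⟨⟨CosetCat.mapOpen T.aug T.isOpenMap_aug
    (e.functor.obj ((CosetCat.pull T.aug T.continuous_aug T.surjective_aug).obj A)).sg⟩, ⟨eqToIso ?_⟩⟩
  apply CosetCat.ext
  apply OpenSubgroup.toSubgroup_injective
  change ((e.functor.obj ((CosetCat.pull T.aug T.continuous_aug T.surjective_aug).obj A)).sg.toSubgroup.map
      T.aug).comap T.aug =
    (e.functor.obj ((CosetCat.pull T.aug T.continuous_aug T.surjective_aug).obj A)).sg.toSubgroup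
  exact Subgroup.comap_map_eq_self hker

/-- The binder `hΔ` is EMPTY when `aug` is injective (`Δ_v = 1`; no covering, `Π_v = G_v`).
([IUTchI] Ex 3.2 (vi) (a) p.73) [claim: Mochizuki2012, status: disputed] -/
theorem forall_map_ker_of_injective (hinj : Function.Injective T.aug) (φ : P ≃ₜ* P) :
    T.aug.ker.map φ.toMulEquiv.toMonoidHom = T.aug.ker := by
  rw [(MonoidHom.ker_eq_bot_iff T.aug).mpr hinj, Subgroup.map_bot]

end BadLocalGroupDatum

/-! ### §2 (vi)(a) for the assembly `BadLocalFrobenioid.ofKits` -/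

namespace BadLocalFrobenioid

variable {p : ℕ} [Fact p.Prime] (l : ℕ) (d : GaloisValDatum.{0} p) {P : Type} [Group P] [TopologicalSpace P]
  (T : BadLocalGroupDatum d.Gal P) (q qroot : intNonzero d.k) (hpow : qroot ^ (2 * l) = q) (hq : ¬ IsUnit qroot)
  {Fv : Type} [Category.{0} Fv] {Fbirat : Type} [Category.{0} Fbirat] {Cv : Type} [Category.{0} Cv]
  (K : TemperedThetaInput d T hq Fv Fbirat Cv)

/-- **[IUTchI] Ex. 3.2 (vi) (a) for the assembly `ofKits`** (REAL bases `D_v = CosetCat Π_v ⊇ D⊢_v = CosetCat G_v`,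
`G_v = Gal(Ω/K_v)` of a `GaloisValDatum`, tempered side INPUT): for `Π_v` TEMPERED and Galois-countable,
CONDITIONAL on [AbsAnab] Lem. 1.3.8 in the tempered unfolded form `hΔ`, the typed node `DdashFromD` ("`D⊢_v ⊆ D_v`
may be reconstructed category-theoretically from `D_v`") HOLDS — through abc-iut-w4-d047's socket
`ddashFromD_of_essImage_invariant`. ([IUTchI] Ex 3.2 (vi) (a) p.73) [claim: Mochizuki2012, status: disputed] -/
theorem ddashFromD_ofKits_of_forall_map_ker [IsTopologicalGroup P] [SecondCountableTopology P]
    (hP : IsTempered P) (hΔ : ∀ φ : P ≃ₜ* P, T.aug.ker.map φ.toMulEquiv.toMonoidHom = T.aug.ker) :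
    (ofKits l d T q qroot hpow hq K).DdashFromD := by
  apply ddashFromD_of_essImage_invariant
  intro e A
  exact T.incl_essImage_invariant_of_forall_map_ker hP hΔ e A

/-- **(vi)(a) for `ofKits` UNCONDITIONALLY when `aug` is injective** (no covering: `Π_v ≅ G_v`, `Δ_v = 1`) — the
anabelian binder is vacuous there; non-vacuity of the conditional at tempered Galois-countable `Π_v`.
([IUTchI] Ex 3.2 (vi) (a) p.73) [claim: Mochizuki2012, status: disputed] -/
theorem ddashFromD_ofKits_of_injective [IsTopologicalGroup P] [SecondCountableTopology P]
    (hP : IsTempered P) (hinj : Function.Injective T.aug) : (ofKits l d T q qroot hpow hq K).DdashFromD :=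
  ddashFromD_ofKits_of_forall_map_ker l d T q qroot hpow hq K hP (T.forall_map_ker_of_injective hinj)

end BadLocalFrobenioid

/-! ### §3 (vi)(a) for the initial Θ-datum at `v̲ = w ∣ v ∈ V(F)^bad`, `K_v̲ = K_w`, every input group datum -/

section Datum

open NumberField IsDedekindDomain

variable {F K Fbar : Type} [Field F] [NumberField F] [Field K] [NumberField K] [Algebra F K]
  [Field Fbar] [Algebra F Fbar] [Algebra K Fbar] [IsScalarTower F K Fbar] {E : WeierstrassCurve F}
  [E.IsElliptic] {l : ℕ} {Pb : BadPlacePredicates K} (D : InitialThetaData F K Fbar E l Pb)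
  {v : FinitePlace F} (hv : v ∈ D.VFbad) (w : HeightOneSpectrum (𝓞 K)) [w.asIdeal.LiesOver v.maximalIdeal.asIdeal]
  (p : ℕ) [Fact p.Prime] (hw : ((p : ℕ) : 𝓞 K) ∈ w.asIdeal)

namespace InitialThetaData

/-- **[IUTchI] Ex. 3.2 (vi) (a) AT THE GENUINE DATUM** `badLocalFrobenioidAt` (initial Θ-data `D`, `v̲ = w ∣ v ∈
V(F)^bad`, `K_v̲ := K_w`, `G_v̲ := Gal(K̄_w/K_w)`, `D⊢_v̲ = 𝓑(K_v̲)⁰`, genuine `q_v̲`, `q̲_v̲`, `C⊢_v̲`), for EVERY input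
group datum `Π_v̲ → G_v̲ ⊇ Π_Ÿ` on a TEMPERED Galois-countable `Π_v̲` and EVERY tempered-side input `Kt`, CONDITIONAL
on [AbsAnab] Lem. 1.3.8 in the tempered unfolded form `hΔ` for `Π_v̲ ↠ G_v̲`: `D⊢_v̲ ⊆ D_v̲` is reconstructible
category-theoretically from `D_v̲`. ([IUTchI] Ex 3.2 (vi) (a) p.73) [claim: Mochizuki2012, status: disputed] -/
theorem ddashFromD_badLocalFrobenioidAt_of_forall_map_ker {P : Type} [Group P] [TopologicalSpace P]
    [IsTopologicalGroup P] [SecondCountableTopology P]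
    (T : BadLocalGroupDatum (GaloisValDatum.ofPlace K p w hw).Gal P) {Fv : Type} [Category.{0} Fv] {Fbirat : Type}
    [Category.{0} Fbirat] {Cv : Type} [Category.{0} Cv]
    (Kt : TemperedThetaInput (GaloisValDatum.ofPlace K p w hw) T (D.qRootAt_not_isUnit hv w p hw) Fv Fbirat Cv)
    (hP : IsTempered P) (hΔ : ∀ φ : P ≃ₜ* P, T.aug.ker.map φ.toMulEquiv.toMonoidHom = T.aug.ker) :
    (D.badLocalFrobenioidAt hv w p hw T Kt).DdashFromD :=
  BadLocalFrobenioid.ddashFromD_ofKits_of_forall_map_ker l _ T _ _ _ _ Kt hP hΔ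

/-- **(vi)(a) at the genuine datum UNCONDITIONALLY for an input group datum with injective `aug`** (no covering) —
non-vacuity of the conditional over the GENUINE `K_v̲ = K_w`, `q_v̲`, `C⊢_v̲`.
([IUTchI] Ex 3.2 (vi) (a) p.73) [claim: Mochizuki2012, status: disputed] -/
theorem ddashFromD_badLocalFrobenioidAt_of_injective {P : Type} [Group P] [TopologicalSpace P]
    [IsTopologicalGroup P] [SecondCountableTopology P]
    (T : BadLocalGroupDatum (GaloisValDatum.ofPlace K p w hw).Gal P) {Fv : Type} [Category.{0} Fv] {Fbirat : Type}
    [Category.{0} Fbirat] {Cv : Type} [Category.{0} Cv]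
    (Kt : TemperedThetaInput (GaloisValDatum.ofPlace K p w hw) T (D.qRootAt_not_isUnit hv w p hw) Fv Fbirat Cv)
    (hP : IsTempered P) (hinj : Function.Injective T.aug) :
    (D.badLocalFrobenioidAt hv w p hw T Kt).DdashFromD :=
  BadLocalFrobenioid.ddashFromD_ofKits_of_injective l _ T _ _ _ _ Kt hP hinj

end InitialThetaData

end Datum

/-! ### §4 (vi)(a) AT THE [EtTh] §1 OBJECTS: `Π_v̲ := Π^tp_{X̲̲}` of the double-underline curve -/

namespace BadLocalGroupDatum

variable {p : ℕ} [Fact p.Prime] {S : ThetaSetting p} {ES : S.EtaleThetaData} {l : ℕ}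

/-- **`Π^tp_{X̲̲}` is TEMPERED** — an open (hence closed) subgroup of the tempered `Π^tp_X` (abc-iut-L3's
`GroupLevelData.isTempered` + `IsTempered.subgroup_of_isClosed`, the pattern of `GroupLevelData.ofOpenSubgroup`).
[cite: MochizukiSemiAnbd2006, Def 3.1(i) p.33] -/
theorem isTempered_Huu (dGL : S.toTemperedCurve.GroupLevelData) (C : ES.DoubleUnderline l) : IsTempered ↥C.Huu :=
  dGL.isTempered.subgroup_of_isClosed C.Huu (Subgroup.isClosed_of_isOpen C.Huu C.isOpen_Huu)

/-- **`Π^tp_{X̲̲}` is Galois-countable** (second countable), as a subspace of the Galois-countable `Π^tp_X` (abc-iut-L3's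
`GroupLevelData.secondCountableTopology`). [cite: MochizukiSemiAnbd2006, §6 p.69] -/
theorem secondCountableTopology_Huu (dGL : S.toTemperedCurve.GroupLevelData) (C : ES.DoubleUnderline l) :
    SecondCountableTopology ↥C.Huu := by
  haveI : SecondCountableTopology S.PiTemp := dGL.secondCountableTopology
  exact TopologicalSpace.Subtype.secondCountableTopology (C.Huu : Set S.PiTemp)

variable {G : Type} [Group G] [TopologicalSpace G]

/-- **`Ker(Π^tp_{X̲̲} → G) = Δ^tp_{X̲̲} := Δ^tp_X ∩ Π^tp_{X̲̲}`** for the junction datum `ofDoubleUnderline` (the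
identification `ι : G_K ≃ₜ* G` is an isomorphism, so the kernel does not depend on it).
[cite: Mochizuki2012, I Ex 3.2 (i) p.70] -/
theorem ker_aug_ofDoubleUnderline (dGL : S.toTemperedCurve.GroupLevelData) (hS2 : S.Sec2Hyps)
    (C : ES.DoubleUnderline l) (ι : ↥S.GK ≃ₜ* G) :
    (ofDoubleUnderline dGL hS2 C ι).aug.ker = S.aug.toMonoidHom.ker.subgroupOf C.Huu := by
  ext x
  rw [MonoidHom.mem_ker, Subgroup.mem_subgroupOf, MonoidHom.mem_ker, ofDoubleUnderline_aug,
    augOfDoubleUnderline_apply, EmbeddingLike.map_eq_one_iff]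
  change S.toTemperedCurve.augGK (x : S.PiTemp) = 1 ↔ S.aug (x : S.PiTemp) = 1
  rw [← OneMemClass.coe_eq_one, TemperedCurve.coe_augGK_apply]

end BadLocalGroupDatum

section DoubleUnderline

open NumberField IsDedekindDomain

variable {F K Fbar : Type} [Field F] [NumberField F] [Field K] [NumberField K] [Algebra F K]
  [Field Fbar] [Algebra F Fbar] [Algebra K Fbar] [IsScalarTower F K Fbar] {E : WeierstrassCurve F}
  [E.IsElliptic] {l : ℕ} {Pb : BadPlacePredicates K} (D : InitialThetaData F K Fbar E l Pb)
  {v : FinitePlace F} (hv : v ∈ D.VFbad) (w : HeightOneSpectrum (𝓞 K)) [w.asIdeal.LiesOver v.maximalIdeal.asIdeal]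
  (p : ℕ) [Fact p.Prime] (hw : ((p : ℕ) : 𝓞 K) ∈ w.asIdeal)
  {S : ThetaSetting p} {ES : S.EtaleThetaData} (dGL : S.toTemperedCurve.GroupLevelData) (hS2 : S.Sec2Hyps)
  (C : ES.DoubleUnderline l) (ι : ↥S.GK ≃ₜ* (GaloisValDatum.ofPlace K p w hw).Gal)
  {Fv : Type} [Category.{0} Fv] {Fbirat : Type} [Category.{0} Fbirat] {Cv : Type} [Category.{0} Cv]
  (Kt : TemperedThetaInput (GaloisValDatum.ofPlace K p w hw) (InitialThetaData.badGroupDatumOfDoubleUnderline w p hw dGL hS2 C ι)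
    (D.qRootAt_not_isUnit hv w p hw) Fv Fbirat Cv)

namespace InitialThetaData

/-- **[IUTchI] Ex. 3.2 (vi) (a) AT THE GENUINE DATUM over the GENUINE group datum** (`badLocalFrobenioidAtDoubleUnderline`:
`Π_v̲ := Π^tp_{X̲̲}` of the [EtTh] §1 double-underline curve, `aug := ι ∘ aug_{G_K}|`, `K_v̲ = K_w`, genuine `q_v̲`,
`q̲_v̲`, `C⊢_v̲`; tempered side `Kt` INPUT).  Temperedness and Galois-countability of `Π^tp_{X̲̲}` are theorems here
(abc-iut-L3's group-level bundle `dGL` by name), so the ONLY displayed hypothesis is [AbsAnab] Lem. 1.3.8 in the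
tempered, `ι`-free unfolded form `hΔ`: "`Δ^tp_{X̲̲} = Δ^tp_X ∩ Π^tp_{X̲̲}` is carried onto itself by every bicontinuous
automorphism of `Π^tp_{X̲̲}`".  Then `D⊢_v̲ ⊆ D_v̲ = 𝓑^temp(X̲̲_v̲)⁰` is reconstructible category-theoretically from `D_v̲`.
([IUTchI] Ex 3.2 (vi) (a) p.73) [claim: Mochizuki2012, status: disputed] -/
theorem ddashFromD_badLocalFrobenioidAtDoubleUnderline_of_forall_map_ker
    (hΔ : ∀ φ : ↥C.Huu ≃ₜ* ↥C.Huu,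
      (S.aug.toMonoidHom.ker.subgroupOf C.Huu).map φ.toMulEquiv.toMonoidHom =
        S.aug.toMonoidHom.ker.subgroupOf C.Huu) :
    (D.badLocalFrobenioidAtDoubleUnderline hv w p hw dGL hS2 C ι Kt).DdashFromD := by
  haveI := BadLocalGroupDatum.secondCountableTopology_Huu dGL C
  refine D.ddashFromD_badLocalFrobenioidAt_of_forall_map_ker hv w p hw _ Kt
    (BadLocalGroupDatum.isTempered_Huu dGL C) fun φ => ?_
  rw [BadLocalGroupDatum.ker_aug_ofDoubleUnderline]
  exact hΔ φ

end InitialThetaData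

end DoubleUnderline

end Literature.IUT.HodgeTheaters

end
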